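import Literature.AlgebraicGeometry.Resolution.DifferentialOperators
import HarnessLib

/-!
# Differential operators from an algebra to an algebra over it (commutator definition)

Topic `Literature/AlgebraicGeometry/Resolution`; companion of `DifferentialOperators.lean`, which defines
`IsDiffOpLE R n D` for `R`-linear ENDOmorphisms `D : A → A` by Grothendieck's commutator recursion (EGA IV₄ Prop.
16.8.8 (b): order `≤ 0` iff all `[D, a]` vanish, order `≤ n + 1` iff all `[D, a]` have order `≤ n`).

This file extends the predicate to `R`-linear maps `T : A → B` into a commutative `A`-algebra `B` (typically a
localization `B = A_f`, file `DiffOpLocalizationExtend.lean`): `commOver R T a = [T, a] : t ↦ T (a t) − a T t` and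
`IsDiffOpOver R n T`, with the closure properties (`zero`, `add`, `smul`, `comp_mulLeft`, `mono`, `of_le`), the two
comparison lemmas with `IsDiffOpLE` (`IsDiffOpLE.isDiffOpOver_comp`: `D ↦ ι ∘ D`; `IsDiffOpLE.isDiffOpOver_comp_algebraLinearMap`:
`D̃ ↦ D̃ ∘ ι`, `ι : A → B` the structure map), and three commutator identities on `B` used downstream: the product rule
`[D, b c] = [D, b] ∘ (c·) + b • [D, c]` (`commMul_mul`), `[D, 1] = 0`, and `[D, u] = −u • ([D, v] ∘ (u·))` for `u v = 1`
(`commMul_inv_of_mul_eq_one`) — the last is why an operator on `A_f` is controlled by its commutators with elements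
of `A`.

Source for the notion: EGA IV₄ §16.8 (Déf. 16.8.1, Prop. 16.8.8), as in `DifferentialOperators.lean`; the `A → B`
variant is the evident generalisation («Diff^n_{X/S}(ℱ, 𝒢)» for two Modules, here `ℱ = 𝒪`, `𝒢 = B̃`), written in the
tree's commutator formalism. Everything here is elementary algebra ([folklore]). [EGAIV4]
-/

namespace Literature.AlgebraicGeometry.Resolution

section Over

variable (R : Type*) {A B : Type*} [CommRing R] [CommRing A] [CommRing B] [Algebra R A] [Algebra R B]
  [Algebra A B]

/-! ### Differential operators from `A` to an `A`-algebra `B` -/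

/-- `commOver R T a = [T, a]` for an `R`-linear map `T : A → B` into an `A`-algebra `B`:
`t ↦ T (a t) − a · T t`. [cite: EGAIV4, Prop. 16.8.8 (16.8.8.1) p.42 (the commutator D_a; here for operators A → B)] -/
def commOver (T : A →ₗ[R] B) (a : A) : A →ₗ[R] B :=
  T ∘ₗ LinearMap.mulLeft R a - algebraMap A B a • T

/-- `[T, a] t = T (a t) − a T t`. [cite: EGAIV4, Prop. 16.8.8 (16.8.8.1) p.42 (the commutator D_a; here for operators A → B)] -/
@[simp] theorem commOver_apply (T : A →ₗ[R] B) (a t : A) :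
    commOver R T a t = T (a * t) - algebraMap A B a * T t := rfl

/-- `[0, a] = 0`. [cite: EGAIV4, Prop. 16.8.8 (16.8.8.1) p.42 (the commutator D_a; here for operators A → B)] -/
@[simp] theorem commOver_zero_left (a : A) : commOver R (0 : A →ₗ[R] B) a = 0 := by
  ext t; simp

/-- `[T + T', a] = [T, a] + [T', a]`. [cite: EGAIV4, Prop. 16.8.8 (16.8.8.1) p.42 (the commutator D_a; here for operators A → B)] -/
theorem commOver_add_left (T T' : A →ₗ[R] B) (a : A) :
    commOver R (T + T') a = commOver R T a + commOver R T' a := by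
  ext t; simp only [commOver_apply, LinearMap.add_apply]; ring

/-- `[c • T, a] = c • [T, a]` for `c ∈ B`. [cite: EGAIV4, Prop. 16.8.8 (16.8.8.1) p.42 (the commutator D_a; here for operators A → B)] -/
theorem commOver_smul_left (c : B) (T : A →ₗ[R] B) (a : A) :
    commOver R (c • T) a = c • commOver R T a := by
  ext t; simp only [commOver_apply, LinearMap.smul_apply, smul_eq_mul]; ring

/-- `[T ∘ (a'·), a] = [T, a] ∘ (a'·)`. [cite: EGAIV4, Prop. 16.8.8 (16.8.8.1) p.42 (the commutator D_a; here for operators A → B)] -/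
theorem commOver_comp_mulLeft (T : A →ₗ[R] B) (a a' : A) :
    commOver R (T ∘ₗ LinearMap.mulLeft R a') a = commOver R T a ∘ₗ LinearMap.mulLeft R a' := by
  ext t; simp only [commOver_apply, LinearMap.comp_apply, LinearMap.mulLeft_apply]; ring_nf

/-- Commutators with different elements commute: `[[T, a], a'] = [[T, a'], a]`. [cite: EGAIV4, Prop. 16.8.8 (16.8.8.1) p.42 (the commutator D_a; here for operators A → B)] -/
theorem commOver_comm (T : A →ₗ[R] B) (a a' : A) :
    commOver R (commOver R T a) a' = commOver R (commOver R T a') a := by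
  ext t; simp only [commOver_apply]; ring_nf

/-- **`IsDiffOpOver R n T`**: the `R`-linear map `T : A → B` (into an `A`-algebra `B`) is a differential
operator of order `≤ n` in the sense of the commutator criterion: order `≤ 0` iff all `[T, a]` vanish, order
`≤ n + 1` iff all `[T, a]` have order `≤ n`. For `B = A` this is `IsDiffOpLE`. [cite: EGAIV4, Déf. 16.8.1 with Prop. 16.8.8 (b) p.40–42 (commutator recursion; operators A → B)] -/
def IsDiffOpOver : ℕ → (A →ₗ[R] B) → Prop
  | 0, T => ∀ a : A, commOver R T a = 0
  | n + 1, T => ∀ a : A, IsDiffOpOver n (commOver R T a)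

variable {R}

namespace IsDiffOpOver

/-- `0` has every order. [cite: EGAIV4, Déf. 16.8.1 with Prop. 16.8.8 (b) p.40–42 (commutator recursion; operators A → B)] -/
theorem zero : ∀ n : ℕ, IsDiffOpOver R n (0 : A →ₗ[R] B)
  | 0 => fun a => commOver_zero_left R a
  | n + 1 => fun a => by rw [commOver_zero_left]; exact zero n

/-- Sums. [cite: EGAIV4, Déf. 16.8.1 with Prop. 16.8.8 (b) p.40–42 (commutator recursion; operators A → B)] -/
theorem add : ∀ {n : ℕ} {T T' : A →ₗ[R] B},
    IsDiffOpOver R n T → IsDiffOpOver R n T' → IsDiffOpOver R n (T + T')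
  | 0, _, _, h, h' => fun a => by rw [commOver_add_left, h a, h' a, add_zero]
  | n + 1, _, _, h, h' => fun a => by rw [commOver_add_left]; exact add (h a) (h' a)

/-- `B`-multiples. [cite: EGAIV4, Déf. 16.8.1 with Prop. 16.8.8 (b) p.40–42 (commutator recursion; operators A → B)] -/
theorem smul (c : B) : ∀ {n : ℕ} {T : A →ₗ[R] B}, IsDiffOpOver R n T → IsDiffOpOver R n (c • T)
  | 0, _, h => fun a => by rw [commOver_smul_left, h a, smul_zero]
  | n + 1, _, h => fun a => by rw [commOver_smul_left]; exact smul c (h a)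

/-- Pre-composition with a multiplication. [cite: EGAIV4, Déf. 16.8.1 with Prop. 16.8.8 (b) p.40–42 (commutator recursion; operators A → B)] -/
theorem comp_mulLeft (a' : A) : ∀ {n : ℕ} {T : A →ₗ[R] B},
    IsDiffOpOver R n T → IsDiffOpOver R n (T ∘ₗ LinearMap.mulLeft R a')
  | 0, _, h => fun a => by rw [commOver_comp_mulLeft, h a, LinearMap.zero_comp]
  | n + 1, _, h => fun a => by rw [commOver_comp_mulLeft]; exact comp_mulLeft a' (h a)

/-- Monotonicity `n ↦ n + 1`. [cite: EGAIV4, Déf. 16.8.1 with Prop. 16.8.8 (b) p.40–42 (commutator recursion; operators A → B)] -/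
theorem mono : ∀ {n : ℕ} {T : A →ₗ[R] B}, IsDiffOpOver R n T → IsDiffOpOver R (n + 1) T
  | 0, _, h => fun a => by rw [h a]; exact zero 0
  | n + 1, _, h => fun a => mono (h a)

/-- Monotonicity in the order. [cite: EGAIV4, Déf. 16.8.1 with Prop. 16.8.8 (b) p.40–42 (commutator recursion; operators A → B)] -/
theorem of_le {m n : ℕ} (hmn : m ≤ n) {T : A →ₗ[R] B} (h : IsDiffOpOver R m T) : IsDiffOpOver R n T := by
  obtain ⟨k, rfl⟩ := Nat.exists_eq_add_of_le hmn
  induction k with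
  | zero => exact h
  | succ k ih => exact (ih (Nat.le_add_right m k)).mono

/-- The defining clause. [cite: EGAIV4, Déf. 16.8.1 with Prop. 16.8.8 (b) p.40–42 (commutator recursion; operators A → B)] -/
theorem of_succ {n : ℕ} {T : A →ₗ[R] B} (h : IsDiffOpOver R (n + 1) T) (a : A) :
    IsDiffOpOver R n (commOver R T a) := h a

/-- Commutators of an operator of order `≤ n` have order `≤ n` (indeed `≤ n − 1`). [cite: EGAIV4, Déf. 16.8.1 with Prop. 16.8.8 (b) p.40–42 (commutator recursion; operators A → B)] -/
theorem commOver_right : ∀ {n : ℕ} {T : A →ₗ[R] B}, IsDiffOpOver R n T →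
    ∀ a, IsDiffOpOver R n (Resolution.commOver R T a)
  | 0, _, h => fun a => by rw [h a]; exact zero 0
  | _ + 1, _, h => fun a => (h a).mono

end IsDiffOpOver

variable [IsScalarTower R A B]

/-- The structure map `A → B` as an `R`-linear map. [folklore] -/
abbrev algebraLinearMap (R : Type*) (A B : Type*) [CommRing R] [CommRing A] [CommRing B] [Algebra R A]
    [Algebra R B] [Algebra A B] [IsScalarTower R A B] : A →ₗ[R] B :=
  (IsScalarTower.toAlgHom R A B).toLinearMap

/-- `algebraLinearMap R A B a = algebraMap A B a` (plumbing). [folklore] -/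
@[simp] private theorem algebraLinearMap_apply (a : A) : algebraLinearMap R A B a = algebraMap A B a := rfl

/-- `[ι ∘ D, a] = ι ∘ [D, a]` for the structure map `ι : A → B`. [cite: EGAIV4, Prop. 16.8.8 (16.8.8.1) p.42 (the commutator D_a; here for operators A → B)] -/
theorem commOver_algebraLinearMap_comp (D : A →ₗ[R] A) (a : A) :
    commOver R (algebraLinearMap R A B ∘ₗ D) a = algebraLinearMap R A B ∘ₗ commMul R D a := by
  ext t; simp [commOver_apply, commMul_apply, map_sub, map_mul]

/-- A differential operator `D` of order `≤ n` on `A`, followed by `A → B`, is a differential operator of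
order `≤ n` from `A` to `B`. [cite: EGAIV4, Déf. 16.8.1 with Prop. 16.8.8 (b) p.40–42 (commutator recursion; operators A → B)] -/
theorem IsDiffOpLE.isDiffOpOver_comp : ∀ {n : ℕ} {D : A →ₗ[R] A},
    IsDiffOpLE R n D → IsDiffOpOver R n (algebraLinearMap R A B ∘ₗ D)
  | 0, _, h => fun a => by rw [commOver_algebraLinearMap_comp, h a, LinearMap.comp_zero]
  | n + 1, _, h => fun a => by rw [commOver_algebraLinearMap_comp]; exact (h a).isDiffOpOver_comp

/-- `[D̃ ∘ ι, a] = [D̃, ι a] ∘ ι`. [cite: EGAIV4, Prop. 16.8.8 (16.8.8.1) p.42 (the commutator D_a; here for operators A → B)] -/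
theorem commOver_comp_algebraLinearMap (D : B →ₗ[R] B) (a : A) :
    commOver R (D ∘ₗ algebraLinearMap R A B) a = commMul R D (algebraMap A B a) ∘ₗ algebraLinearMap R A B := by
  ext t; simp [commOver_apply, commMul_apply, map_mul]

/-- A differential operator of order `≤ n` on `B`, restricted along `A → B`, has order `≤ n` from `A` to
`B`. [cite: EGAIV4, Déf. 16.8.1 with Prop. 16.8.8 (b) p.40–42 (commutator recursion; operators A → B)] -/
theorem IsDiffOpLE.isDiffOpOver_comp_algebraLinearMap : ∀ {n : ℕ} {D : B →ₗ[R] B},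
    IsDiffOpLE R n D → IsDiffOpOver R n (D ∘ₗ algebraLinearMap R A B)
  | 0, _, h => fun a => by rw [commOver_comp_algebraLinearMap, h _, LinearMap.zero_comp]
  | n + 1, _, h => fun a => by
      rw [commOver_comp_algebraLinearMap]; exact (h _).isDiffOpOver_comp_algebraLinearMap

/-! ### Commutators on `B`: product rule and generation -/

/-- Product rule for commutators: `[D, b c] = [D, b] ∘ (c·) + b • [D, c]`. [cite: EGAIV4, Prop. 16.8.8 (16.8.8.1) p.42 (the commutator D_a; here for operators A → B)] -/
theorem commMul_mul (D : B →ₗ[R] B) (b c : B) :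
    commMul R D (b * c) = commMul R D b ∘ₗ LinearMap.mulLeft R c + b • commMul R D c := by
  ext t
  simp only [commMul_apply, LinearMap.add_apply, LinearMap.comp_apply, LinearMap.mulLeft_apply,
    LinearMap.smul_apply, smul_eq_mul]
  ring_nf

/-- `[D, 1] = 0`. [cite: EGAIV4, Prop. 16.8.8 (16.8.8.1) p.42 (the commutator D_a; here for operators A → B)] -/
@[simp] theorem commMul_one (D : B →ₗ[R] B) : commMul R D 1 = 0 := by
  ext t; simp [commMul_apply]

/-- Commutator with the inverse of a unit: `[D, u] = −u • ([D, v] ∘ (u·))` when `u v = 1`. [cite: EGAIV4, Prop. 16.8.8 (16.8.8.1) p.42 (the commutator D_a; here for operators A → B)] -/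
theorem commMul_inv_of_mul_eq_one (D : B →ₗ[R] B) {u v : B} (huv : u * v = 1) :
    commMul R D u = (-u) • (commMul R D v ∘ₗ LinearMap.mulLeft R u) := by
  ext t
  simp only [commMul_apply, LinearMap.smul_apply, LinearMap.comp_apply, LinearMap.mulLeft_apply,
    smul_eq_mul]
  have h1 : D (v * (u * t)) = D t := by rw [← mul_assoc, mul_comm v u, huv, one_mul]
  rw [h1]
  have h2 : -u * (D t - v * D (u * t)) = - (u * D t) + (u * v) * D (u * t) := by ring
  rw [h2, huv, one_mul]
  ring

end Over

end Literature.AlgebraicGeometry.Resolution
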